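import Summits.NavierStokesRegularity.NavierStokesRegularity.Theorems.RellichScarScarRigidityVorticityDefectIBP
import HarnessLib

/-!
# `ScarRigidity`, line `moment-conditioned-rellich` — stub `stub_biotSavartFarField` (BS), part 5:
# moments of an antisymmetric, cyclic, sextically flat matrix field

Crux stmt-NavierStokesRegularity-11717 (route RellichScar), helper file (`--supports`) for the registered stub
`stub_biotSavartFarField` (skeleton `Cruxes/ScarRigidity/Lines/moment_conditioned_rellich.lean`).

Abstract version of the moment bookkeeping for the antisymmetric gradient `A_ij = ∂ᵢw_j − ∂ⱼw_i` of the twin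
difference.  Let `A : Fin 3 → Fin 3 → (ℝ³ → ℝ)` be `C¹` with `|A_ij| ≤ K₀/(‖y‖+a)⁶`, `‖DA_ij‖ ≤ K₁/(‖y‖+a)⁷`
(`a > 0`), antisymmetric (`A_ji = −A_ij`) and cyclic (`∂_lA_mj + ∂_mA_jl + ∂_jA_lm = 0`).  Then:

* **`∫ A_mj = 0`** (`integral_antisym_cyclic_eq_zero`): `Σ_l ∫ y_l ∂_lA_mj = −3 ∫ A_mj` by parts, while the
  cyclic identity and `∫ y_l ∂_mA_jl = −δ_ml ∫ A_jl` give `Σ_l ∫ y_l ∂_lA_mj = 2 ∫ A_jm = −2 ∫ A_mj` —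
  the total vorticity of a decaying closed two-form vanishes with NO hypothesis on `w` itself;
* the moments of the divergence rows `f_j = Σᵢ ∂ᵢA_ij` (`= (Δw)_j` for divergence-free `w`, part 4):
  `∫ f_j = 0`, `∫ y_l f_j = −∫ A_lj = 0`, and `∫ y_l y_n f_j = −∫ y_n A_lj − ∫ y_l A_nj`, which vanishes when
  the first moments `∫ y_m A_ij` do (`integral_sum_fderiv_eq_zero`, `integral_coord_mul_sum_fderiv_eq_zero`,
  `integral_coord_mul_coord_mul_sum_fderiv_eq_zero`).
-/

noncomputable section

open Set Filter Function MeasureTheory Metric TopologicalSpace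
open scoped Topology

set_option linter.dupNamespace false -- D-0017: `Summit.<S>.<S>.…` repeats the summit name by design

namespace Summit.NavierStokesRegularity.NavierStokesRegularity.Theorems.RellichScarScarRigidity

open Literature.Analysis.FluidPDE

/-! ### Second moments by parts -/

/-- **`∫ y_l y_n ∂ᵢg = −δ_{li} ∫ y_n g − δ_{ni} ∫ y_l g`** on `ℝ³` for `g ∈ C¹` with `y_l g`, `y_n g`, `y_l y_n g`,
`y_l y_n ∂ᵢg ∈ L¹` (no boundary terms for the integrable `C¹` function `y_l y_n g`). [folklore] -/
theorem integral_coord_mul_coord_mul_fderiv_apply {g : EuclideanSpace ℝ (Fin 3) → ℝ} (hg : ContDiff ℝ 1 g)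
    (l n i : Fin 3) (hl : Integrable (fun y : EuclideanSpace ℝ (Fin 3) => y l * g y) volume)
    (hn : Integrable (fun y : EuclideanSpace ℝ (Fin 3) => y n * g y) volume)
    (hln : Integrable (fun y : EuclideanSpace ℝ (Fin 3) => y l * y n * g y) volume)
    (hd : Integrable (fun y : EuclideanSpace ℝ (Fin 3) =>
      y l * y n * fderiv ℝ g y (EuclideanSpace.single i (1 : ℝ))) volume) :
    ∫ y : EuclideanSpace ℝ (Fin 3), y l * y n * fderiv ℝ g y (EuclideanSpace.single i (1 : ℝ)) =
      -((EuclideanSpace.single i (1 : ℝ) : EuclideanSpace ℝ (Fin 3)) l * ∫ y : EuclideanSpace ℝ (Fin 3), y n * g y) -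
        (EuclideanSpace.single i (1 : ℝ) : EuclideanSpace ℝ (Fin 3)) n * ∫ y : EuclideanSpace ℝ (Fin 3), y l * g y := by
  have hcl : ContDiff ℝ 1 fun y : EuclideanSpace ℝ (Fin 3) => y l :=
    (EuclideanSpace.proj l : EuclideanSpace ℝ (Fin 3) →L[ℝ] ℝ).contDiff
  have hcn : ContDiff ℝ 1 fun y : EuclideanSpace ℝ (Fin 3) => y n :=
    (EuclideanSpace.proj n : EuclideanSpace ℝ (Fin 3) →L[ℝ] ℝ).contDiff
  have hH : ContDiff ℝ 1 fun y : EuclideanSpace ℝ (Fin 3) => y l * y n * g y := (hcl.mul hcn).mul hg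
  have hHd : ∀ y : EuclideanSpace ℝ (Fin 3),
      fderiv ℝ (fun y : EuclideanSpace ℝ (Fin 3) => y l * y n * g y) y (EuclideanSpace.single i (1 : ℝ)) =
        (EuclideanSpace.single i (1 : ℝ) : EuclideanSpace ℝ (Fin 3)) l * (y n * g y) +
          (EuclideanSpace.single i (1 : ℝ) : EuclideanSpace ℝ (Fin 3)) n * (y l * g y) +
          y l * y n * fderiv ℝ g y (EuclideanSpace.single i (1 : ℝ)) := by
    intro y
    have hgd : DifferentiableAt ℝ g y := hg.differentiable one_ne_zero y
    have hld := (hasFDerivAt_euclidean_coord l y).differentiableAt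
    have hnd := (hasFDerivAt_euclidean_coord n y).differentiableAt
    have hlnd : DifferentiableAt ℝ (fun y : EuclideanSpace ℝ (Fin 3) => y l * y n) y := hld.mul hnd
    rw [fderiv_fun_mul hlnd hgd, fderiv_fun_mul hld hnd, (hasFDerivAt_euclidean_coord l y).fderiv,
      (hasFDerivAt_euclidean_coord n y).fderiv]
    show y l * y n * fderiv ℝ g y (EuclideanSpace.single i (1 : ℝ)) +
      g y * (y l * (EuclideanSpace.single i (1 : ℝ) : EuclideanSpace ℝ (Fin 3)) n +
        y n * (EuclideanSpace.single i (1 : ℝ) : EuclideanSpace ℝ (Fin 3)) l) = _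
    ring
  have h1i : Integrable (fun y : EuclideanSpace ℝ (Fin 3) =>
      (EuclideanSpace.single i (1 : ℝ) : EuclideanSpace ℝ (Fin 3)) l * (y n * g y)) volume := hn.const_mul _
  have h2i : Integrable (fun y : EuclideanSpace ℝ (Fin 3) =>
      (EuclideanSpace.single i (1 : ℝ) : EuclideanSpace ℝ (Fin 3)) n * (y l * g y)) volume := hl.const_mul _
  have h12i : Integrable (fun y : EuclideanSpace ℝ (Fin 3) =>
      (EuclideanSpace.single i (1 : ℝ) : EuclideanSpace ℝ (Fin 3)) l * (y n * g y) +
        (EuclideanSpace.single i (1 : ℝ) : EuclideanSpace ℝ (Fin 3)) n * (y l * g y)) volume := h1i.add h2i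
  have hsum : Integrable (fun y : EuclideanSpace ℝ (Fin 3) =>
      (EuclideanSpace.single i (1 : ℝ) : EuclideanSpace ℝ (Fin 3)) l * (y n * g y) +
        (EuclideanSpace.single i (1 : ℝ) : EuclideanSpace ℝ (Fin 3)) n * (y l * g y) +
        y l * y n * fderiv ℝ g y (EuclideanSpace.single i (1 : ℝ))) volume := h12i.add hd
  have h0 := integral_fderiv_apply_eq_zero_of_integrable hH (EuclideanSpace.single i (1 : ℝ)) hln
    (by simp_rw [hHd]; exact hsum)
  simp_rw [hHd] at h0
  rw [integral_add h12i hd, integral_add h1i h2i, integral_const_mul, integral_const_mul] at h0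
  linarith

/-! ### An antisymmetric, cyclic, flat matrix field -/

section MatrixField

variable {A : Fin 3 → Fin 3 → EuclideanSpace ℝ (Fin 3) → ℝ} {K₀ K₁ a : ℝ}

/-- Integrability of the entries and of their weighted derivatives from the sextic/septic apex bounds. [folklore] -/
theorem integrable_matrixField (hAc : ∀ i j, ContDiff ℝ 1 (A i j)) (ha : 0 < a)
    (hA0 : ∀ i j y, ‖A i j y‖ ≤ K₀ / (‖y‖ + a) ^ 6) (hA1 : ∀ i j y, ‖fderiv ℝ (A i j) y‖ ≤ K₁ / (‖y‖ + a) ^ 7)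
    (i j l n : Fin 3) (v : EuclideanSpace ℝ (Fin 3)) :
    Integrable (A i j) volume ∧
    Integrable (fun y : EuclideanSpace ℝ (Fin 3) => y l * A i j y) volume ∧
    Integrable (fun y : EuclideanSpace ℝ (Fin 3) => y l * y n * A i j y) volume ∧
    Integrable (fun y : EuclideanSpace ℝ (Fin 3) => fderiv ℝ (A i j) y v) volume ∧
    Integrable (fun y : EuclideanSpace ℝ (Fin 3) => y l * fderiv ℝ (A i j) y v) volume ∧
    Integrable (fun y : EuclideanSpace ℝ (Fin 3) => y l * y n * fderiv ℝ (A i j) y v) volume := by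
  have hK₀ : 0 ≤ K₀ := by
    have h := (norm_nonneg _).trans (hA0 i j 0)
    rw [norm_zero, zero_add] at h
    by_contra hK
    exact absurd h (not_le.2 (div_neg_of_neg_of_pos (not_le.1 hK) (by positivity)))
  have hK₁ : 0 ≤ K₁ := by
    have h := (norm_nonneg _).trans (hA1 i j 0)
    rw [norm_zero, zero_add] at h
    by_contra hK
    exact absurd h (not_le.2 (div_neg_of_neg_of_pos (not_le.1 hK) (by positivity)))
  have hc : Continuous (A i j) := (hAc i j).continuous
  have hdc : Continuous fun y => fderiv ℝ (A i j) y v :=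
    ((hAc i j).continuous_fderiv one_ne_zero).clm_apply continuous_const
  have hcl : Continuous fun y : EuclideanSpace ℝ (Fin 3) => y l := (EuclideanSpace.proj l).continuous
  have hcn : Continuous fun y : EuclideanSpace ℝ (Fin 3) => y n := (EuclideanSpace.proj n).continuous
  have hdv : ∀ y, ‖fderiv ℝ (A i j) y v‖ ≤ K₁ * ‖v‖ / (‖y‖ + a) ^ 7 := fun y =>
    calc ‖fderiv ℝ (A i j) y v‖ ≤ ‖fderiv ℝ (A i j) y‖ * ‖v‖ := ContinuousLinearMap.le_opNorm _ _
      _ ≤ K₁ / (‖y‖ + a) ^ 7 * ‖v‖ := mul_le_mul_of_nonneg_right (hA1 i j y) (norm_nonneg _)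
      _ = K₁ * ‖v‖ / (‖y‖ + a) ^ 7 := by ring
  have hw1 : ∀ {f : EuclideanSpace ℝ (Fin 3) → ℝ} {X : ℝ} {p : ℕ}, 0 ≤ X → (∀ y, ‖f y‖ ≤ X / (‖y‖ + a) ^ (p + 1)) →
      ∀ y : EuclideanSpace ℝ (Fin 3), ‖y l * f y‖ ≤ X / (‖y‖ + a) ^ p := by
    intro f X p hX hf y
    rw [norm_mul]
    calc ‖y l‖ * ‖f y‖ ≤ ‖y‖ * (X / (‖y‖ + a) ^ (p + 1)) :=
          mul_le_mul (PiLp.norm_apply_le y l) (hf y) (norm_nonneg _) (norm_nonneg _)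
      _ ≤ X / (‖y‖ + a) ^ p := norm_mul_div_apexWeight_succ_le ha hX p y
  have hw2 : ∀ {f : EuclideanSpace ℝ (Fin 3) → ℝ} {X : ℝ} {p : ℕ}, 0 ≤ X → (∀ y, ‖f y‖ ≤ X / (‖y‖ + a) ^ (p + 1 + 1)) →
      ∀ y : EuclideanSpace ℝ (Fin 3), ‖y l * y n * f y‖ ≤ X / (‖y‖ + a) ^ p := by
    intro f X p hX hf y
    rw [norm_mul, norm_mul]
    calc ‖y l‖ * ‖y n‖ * ‖f y‖ ≤ ‖y‖ * ‖y‖ * (X / (‖y‖ + a) ^ (p + 1 + 1)) :=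
          mul_le_mul (mul_le_mul (PiLp.norm_apply_le y l) (PiLp.norm_apply_le y n) (norm_nonneg _)
            (norm_nonneg _)) (hf y) (norm_nonneg _) (by positivity)
      _ = ‖y‖ * (‖y‖ * (X / (‖y‖ + a) ^ (p + 1 + 1))) := by ring
      _ ≤ ‖y‖ * (X / (‖y‖ + a) ^ (p + 1)) :=
          mul_le_mul_of_nonneg_left (norm_mul_div_apexWeight_succ_le ha hX (p + 1) y) (norm_nonneg _)
      _ ≤ X / (‖y‖ + a) ^ p := norm_mul_div_apexWeight_succ_le ha hX p y
  refine ⟨integrable_of_norm_le_apexWeight hc.aestronglyMeasurable ha (by norm_num) (hA0 i j),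
    integrable_of_norm_le_apexWeight (hcl.mul hc).aestronglyMeasurable ha (p := 5) (by norm_num)
      (hw1 hK₀ (hA0 i j)),
    integrable_of_norm_le_apexWeight ((hcl.mul hcn).mul hc).aestronglyMeasurable ha (p := 4) le_rfl
      (hw2 hK₀ (hA0 i j)),
    integrable_of_norm_le_apexWeight hdc.aestronglyMeasurable ha (by norm_num) hdv,
    integrable_of_norm_le_apexWeight (hcl.mul hdc).aestronglyMeasurable ha (p := 6) (by norm_num)
      (hw1 (by positivity) hdv),
    integrable_of_norm_le_apexWeight ((hcl.mul hcn).mul hdc).aestronglyMeasurable ha (p := 5) (by norm_num)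
      (hw2 (by positivity) hdv)⟩

/-- **The total integral of an antisymmetric, cyclic, flat matrix field vanishes**: `∫ A_mj = 0`
(`−3 ∫ A_mj = Σ_l ∫ y_l ∂_lA_mj = −Σ_l ∫ y_l (∂_mA_jl + ∂_jA_lm) = 2 ∫ A_jm = −2 ∫ A_mj`). [folklore] -/
theorem integral_antisym_cyclic_eq_zero (hAc : ∀ i j, ContDiff ℝ 1 (A i j)) (ha : 0 < a)
    (hA0 : ∀ i j y, ‖A i j y‖ ≤ K₀ / (‖y‖ + a) ^ 6) (hA1 : ∀ i j y, ‖fderiv ℝ (A i j) y‖ ≤ K₁ / (‖y‖ + a) ^ 7)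
    (hanti : ∀ i j y, A j i y = -A i j y)
    (hcyc : ∀ (l m j : Fin 3) (y : EuclideanSpace ℝ (Fin 3)),
      fderiv ℝ (A m j) y (EuclideanSpace.single l (1 : ℝ)) + fderiv ℝ (A j l) y (EuclideanSpace.single m (1 : ℝ)) +
        fderiv ℝ (A l m) y (EuclideanSpace.single j (1 : ℝ)) = 0)
    (m j : Fin 3) : ∫ y, A m j y = 0 := by
  have hI := fun i j l v => integrable_matrixField hAc ha hA0 hA1 i j l l v
  -- `∫ y_l ∂ᵥA_ij = -v_l ∫ A_ij`
  have hparts : ∀ (i j l k : Fin 3), ∫ y : EuclideanSpace ℝ (Fin 3), y l * fderiv ℝ (A i j) y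
      (EuclideanSpace.single k (1 : ℝ)) =
        -((EuclideanSpace.single k (1 : ℝ) : EuclideanSpace ℝ (Fin 3)) l * ∫ y, A i j y) := fun i j l k =>
    integral_coord_mul_fderiv_apply (hAc i j) l k (hI i j l (EuclideanSpace.single k (1 : ℝ))).1
      (hI i j l (EuclideanSpace.single k (1 : ℝ))).2.1 (hI i j l (EuclideanSpace.single k (1 : ℝ))).2.2.2.2.1
  -- antisymmetry of the integrals
  have hantiI : ∫ y, A j m y = -∫ y, A m j y := by
    rw [← integral_neg]; exact integral_congr_ae (Eventually.of_forall fun y => hanti m j y)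
  -- the cyclic identity, multiplied by `y_l` and integrated: `S₁(l) + S₂(l) + S₃(l) = 0`
  have hl : ∀ l : Fin 3,
      (∫ y : EuclideanSpace ℝ (Fin 3), y l * fderiv ℝ (A m j) y (EuclideanSpace.single l (1 : ℝ))) +
        (∫ y : EuclideanSpace ℝ (Fin 3), y l * fderiv ℝ (A j l) y (EuclideanSpace.single m (1 : ℝ))) +
        (∫ y : EuclideanSpace ℝ (Fin 3), y l * fderiv ℝ (A l m) y (EuclideanSpace.single j (1 : ℝ))) = 0 := by
    intro l
    have hi1 := (hI m j l (EuclideanSpace.single l (1 : ℝ))).2.2.2.2.1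
    have hi2 := (hI j l l (EuclideanSpace.single m (1 : ℝ))).2.2.2.2.1
    have hi3 := (hI l m l (EuclideanSpace.single j (1 : ℝ))).2.2.2.2.1
    have hi12 : Integrable (fun y : EuclideanSpace ℝ (Fin 3) =>
        y l * fderiv ℝ (A m j) y (EuclideanSpace.single l (1 : ℝ)) +
          y l * fderiv ℝ (A j l) y (EuclideanSpace.single m (1 : ℝ))) volume := hi1.add hi2
    rw [← integral_add hi1 hi2, ← integral_add hi12 hi3]
    have e : (fun y : EuclideanSpace ℝ (Fin 3) =>
        y l * fderiv ℝ (A m j) y (EuclideanSpace.single l (1 : ℝ)) +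
          y l * fderiv ℝ (A j l) y (EuclideanSpace.single m (1 : ℝ)) +
          y l * fderiv ℝ (A l m) y (EuclideanSpace.single j (1 : ℝ))) = fun _ => 0 := by
      funext y
      rw [← mul_add, ← mul_add, hcyc l m j y, mul_zero]
    rw [e, integral_zero]
  have htot := Finset.sum_eq_zero fun l (_ : l ∈ (Finset.univ : Finset (Fin 3))) => hl l
  rw [Finset.sum_add_distrib, Finset.sum_add_distrib] at htot
  simp_rw [hparts] at htot
  simp only [PiLp.single_apply, ite_mul, one_mul, zero_mul, Finset.sum_ite_eq', Finset.mem_univ,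
    if_true, Finset.sum_neg_distrib, Finset.sum_const, Finset.card_univ, Fintype.card_fin, nsmul_eq_mul,
    Nat.cast_ofNat] at htot
  rw [hantiI] at htot
  linarith

/-- **Zeroth moments of the divergence rows**: `∫ Σᵢ ∂ᵢA_ij = 0`. [folklore] -/
theorem integral_sum_fderiv_eq_zero (hAc : ∀ i j, ContDiff ℝ 1 (A i j)) (ha : 0 < a)
    (hA0 : ∀ i j y, ‖A i j y‖ ≤ K₀ / (‖y‖ + a) ^ 6) (hA1 : ∀ i j y, ‖fderiv ℝ (A i j) y‖ ≤ K₁ / (‖y‖ + a) ^ 7)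
    (j : Fin 3) :
    Integrable (fun y => ∑ i : Fin 3, fderiv ℝ (A i j) y (EuclideanSpace.single i (1 : ℝ))) volume ∧
      ∫ y, ∑ i : Fin 3, fderiv ℝ (A i j) y (EuclideanSpace.single i (1 : ℝ)) = 0 := by
  have hI := fun i => integrable_matrixField hAc ha hA0 hA1 i j j j (EuclideanSpace.single i (1 : ℝ))
  refine ⟨integrable_finsetSum _ fun i _ => (hI i).2.2.2.1, ?_⟩
  rw [integral_finsetSum _ fun i _ => (hI i).2.2.2.1]
  exact Finset.sum_eq_zero fun i _ =>
    integral_fderiv_apply_eq_zero_of_integrable (hAc i j) _ (hI i).1 (hI i).2.2.2.1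

/-- **First moments of the divergence rows**: `∫ y_l Σᵢ ∂ᵢA_ij = −∫ A_lj = 0`. [folklore] -/
theorem integral_coord_mul_sum_fderiv_eq_zero (hAc : ∀ i j, ContDiff ℝ 1 (A i j)) (ha : 0 < a)
    (hA0 : ∀ i j y, ‖A i j y‖ ≤ K₀ / (‖y‖ + a) ^ 6) (hA1 : ∀ i j y, ‖fderiv ℝ (A i j) y‖ ≤ K₁ / (‖y‖ + a) ^ 7)
    (hanti : ∀ i j y, A j i y = -A i j y)
    (hcyc : ∀ (l m j : Fin 3) (y : EuclideanSpace ℝ (Fin 3)),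
      fderiv ℝ (A m j) y (EuclideanSpace.single l (1 : ℝ)) + fderiv ℝ (A j l) y (EuclideanSpace.single m (1 : ℝ)) +
        fderiv ℝ (A l m) y (EuclideanSpace.single j (1 : ℝ)) = 0)
    (l j : Fin 3) :
    Integrable (fun y : EuclideanSpace ℝ (Fin 3) =>
      y l * ∑ i : Fin 3, fderiv ℝ (A i j) y (EuclideanSpace.single i (1 : ℝ))) volume ∧
      ∫ y : EuclideanSpace ℝ (Fin 3), y l * ∑ i : Fin 3, fderiv ℝ (A i j) y (EuclideanSpace.single i (1 : ℝ)) = 0 := by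
  have hI := fun i => integrable_matrixField hAc ha hA0 hA1 i j l l (EuclideanSpace.single i (1 : ℝ))
  have e : ∀ y : EuclideanSpace ℝ (Fin 3), y l * ∑ i : Fin 3, fderiv ℝ (A i j) y (EuclideanSpace.single i (1 : ℝ)) =
      ∑ i : Fin 3, y l * fderiv ℝ (A i j) y (EuclideanSpace.single i (1 : ℝ)) := fun y => Finset.mul_sum _ _ _
  simp_rw [e]
  refine ⟨integrable_finsetSum _ fun i _ => (hI i).2.2.2.2.1, ?_⟩
  rw [integral_finsetSum _ fun i _ => (hI i).2.2.2.2.1]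
  have hparts : ∀ i : Fin 3, ∫ y : EuclideanSpace ℝ (Fin 3), y l * fderiv ℝ (A i j) y
      (EuclideanSpace.single i (1 : ℝ)) = -((EuclideanSpace.single i (1 : ℝ) : EuclideanSpace ℝ (Fin 3)) l *
        ∫ y, A i j y) := fun i =>
    integral_coord_mul_fderiv_apply (hAc i j) l i (hI i).1 (hI i).2.1 (hI i).2.2.2.2.1
  simp_rw [hparts, integral_antisym_cyclic_eq_zero hAc ha hA0 hA1 hanti hcyc]
  simp

/-- **Second moments of the divergence rows**: `∫ y_l y_n Σᵢ ∂ᵢA_ij = −∫ y_n A_lj − ∫ y_l A_nj`, which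
vanishes when the first moments of `A` do. [folklore] -/
theorem integral_coord_mul_coord_mul_sum_fderiv_eq_zero (hAc : ∀ i j, ContDiff ℝ 1 (A i j)) (ha : 0 < a)
    (hA0 : ∀ i j y, ‖A i j y‖ ≤ K₀ / (‖y‖ + a) ^ 6) (hA1 : ∀ i j y, ‖fderiv ℝ (A i j) y‖ ≤ K₁ / (‖y‖ + a) ^ 7)
    (hmom : ∀ m i j : Fin 3, ∫ y : EuclideanSpace ℝ (Fin 3), y m * A i j y = 0) (l n j : Fin 3) :
    Integrable (fun y : EuclideanSpace ℝ (Fin 3) =>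
      y l * y n * ∑ i : Fin 3, fderiv ℝ (A i j) y (EuclideanSpace.single i (1 : ℝ))) volume ∧
      ∫ y : EuclideanSpace ℝ (Fin 3),
        y l * y n * ∑ i : Fin 3, fderiv ℝ (A i j) y (EuclideanSpace.single i (1 : ℝ)) = 0 := by
  have hIl := fun i => integrable_matrixField hAc ha hA0 hA1 i j l n (EuclideanSpace.single i (1 : ℝ))
  have hIn := fun i => integrable_matrixField hAc ha hA0 hA1 i j n n (EuclideanSpace.single i (1 : ℝ))
  have e : ∀ y : EuclideanSpace ℝ (Fin 3),
      y l * y n * ∑ i : Fin 3, fderiv ℝ (A i j) y (EuclideanSpace.single i (1 : ℝ)) =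
        ∑ i : Fin 3, y l * y n * fderiv ℝ (A i j) y (EuclideanSpace.single i (1 : ℝ)) := fun y =>
    Finset.mul_sum _ _ _
  simp_rw [e]
  refine ⟨integrable_finsetSum _ fun i _ => (hIl i).2.2.2.2.2, ?_⟩
  rw [integral_finsetSum _ fun i _ => (hIl i).2.2.2.2.2]
  have hparts : ∀ i : Fin 3, ∫ y : EuclideanSpace ℝ (Fin 3), y l * y n * fderiv ℝ (A i j) y
      (EuclideanSpace.single i (1 : ℝ)) =
      -((EuclideanSpace.single i (1 : ℝ) : EuclideanSpace ℝ (Fin 3)) l * ∫ y : EuclideanSpace ℝ (Fin 3), y n * A i j y) -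
        (EuclideanSpace.single i (1 : ℝ) : EuclideanSpace ℝ (Fin 3)) n * ∫ y : EuclideanSpace ℝ (Fin 3), y l * A i j y :=
    fun i => integral_coord_mul_coord_mul_fderiv_apply (hAc i j) l n i (hIl i).2.1 (hIn i).2.1 (hIl i).2.2.1
      (hIl i).2.2.2.2.2
  simp_rw [hparts, hmom]
  simp

end MatrixField

/-! ### Registered sub-goal -/

/-- **Registered helper stub `stub_biotSavartVorticityTools`** of `stub_biotSavartFarField` (crux
stmt-NavierStokesRegularity-11717, line `moment-conditioned-rellich`): the total integral of an antisymmetric,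
cyclic, flat matrix field vanishes; second moments by parts. [folklore] -/
theorem stub_biotSavartVorticityTools :
    (∀ (A : Fin 3 → Fin 3 → EuclideanSpace ℝ (Fin 3) → ℝ) (K₀ K₁ a : ℝ), (∀ i j, ContDiff ℝ 1 (A i j)) → 0 < a →
      (∀ i j y, ‖A i j y‖ ≤ K₀ / (‖y‖ + a) ^ 6) → (∀ i j y, ‖fderiv ℝ (A i j) y‖ ≤ K₁ / (‖y‖ + a) ^ 7) →
      (∀ i j y, A j i y = -A i j y) →
      (∀ (l m j : Fin 3) (y : EuclideanSpace ℝ (Fin 3)),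
        fderiv ℝ (A m j) y (EuclideanSpace.single l (1 : ℝ)) + fderiv ℝ (A j l) y (EuclideanSpace.single m (1 : ℝ)) +
          fderiv ℝ (A l m) y (EuclideanSpace.single j (1 : ℝ)) = 0) →
      ∀ m j : Fin 3, ∫ y, A m j y = 0) ∧
    (∀ (g : EuclideanSpace ℝ (Fin 3) → ℝ) (l n i : Fin 3), ContDiff ℝ 1 g →
      Integrable (fun y : EuclideanSpace ℝ (Fin 3) => y l * g y) volume →
      Integrable (fun y : EuclideanSpace ℝ (Fin 3) => y n * g y) volume →
      Integrable (fun y : EuclideanSpace ℝ (Fin 3) => y l * y n * g y) volume →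
      Integrable (fun y : EuclideanSpace ℝ (Fin 3) => y l * y n * fderiv ℝ g y (EuclideanSpace.single i (1 : ℝ))) volume →
      ∫ y : EuclideanSpace ℝ (Fin 3), y l * y n * fderiv ℝ g y (EuclideanSpace.single i (1 : ℝ)) =
        -((EuclideanSpace.single i (1 : ℝ) : EuclideanSpace ℝ (Fin 3)) l * ∫ y : EuclideanSpace ℝ (Fin 3), y n * g y) -
          (EuclideanSpace.single i (1 : ℝ) : EuclideanSpace ℝ (Fin 3)) n * ∫ y : EuclideanSpace ℝ (Fin 3), y l * g y) :=
  ⟨fun _A _K₀ _K₁ _a hAc ha hA0 hA1 hanti hcyc m j => integral_antisym_cyclic_eq_zero hAc ha hA0 hA1 hanti hcyc m j,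
    fun _g l n i hg hl hn hln hd => integral_coord_mul_coord_mul_fderiv_apply hg l n i hl hn hln hd⟩

end Summit.NavierStokesRegularity.NavierStokesRegularity.Theorems.RellichScarScarRigidity

end
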